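import Mathlib
import HarnessLib

/-!
# Crux K2 `PoloidalWindowRigidity` (stmt-NavierStokesRegularity-19708), line `z_shock` — the line's PROVED KINEMATIC RUNG made importable:
# one-phase (plane / travelling-wave) solutions of the autonomous THICK height-evolution are constant

`--supports stmt-NavierStokesRegularity-19708 --as helper` (leafhand-ns-poloidalwindowdoor-3 g4, cell decomp-ns, 2026-08-31).  Mathlib only.
**No stub and no summit is closed by this file; Navier–Stokes regularity is NOT proved here (rung 0).**

The registered skeleton `Cruxes/PoloidalWindowRigidity/Lines/z_shock.lean` (sha16 c3e8eee2, planner ns-idea-8 g0) proves, as the first rung of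
its lever, `travellingThick_rigid`: if `c²·W + k²·Γ∘W` is constant for a continuous profile `W` and a differentiable structure function `Γ`
whose derivative (the slope function `G = Γ'`) takes two different values on every value interval (THICK), then `W` is constant — and its
card (§Prices, P3) records that the rung «may be landed as a Mathlib-only helper `--supports 19708` by any idle prover».  This file lands it
(proof adapted verbatim from the skeleton, credited) and closes the small gap between the rung and the height-evolution equation of the tree
(`…ZShockHeightEvolution`: `w_zz + Δₕ[Γ(w)] = 0`, `Γ' = G` the slope function): a one-phase ansatz `w = W(k·xₕ − c z)` turns the equation
into the ODE `c²W'' + |k|²(Γ∘W)'' = 0`, i.e. `(c²W + |k|²Γ∘W)'' = 0`, and BOUNDEDNESS of `W` (two-sided eternity of the slice in the phase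
variable) kills the linear term:

* `travellingThick_rigid` — the skeleton's rung (adapted from `Lines/z_shock.lean`, planner-ns-idea-8-g0-0; IVT + uniqueness of derivatives).
* `eq_const_of_deriv2_zero_of_bounded` — a `C²` function on `ℝ` with vanishing second derivative and bounded values is constant.
* `onePhase_const_of_thick` — ★ `W ∈ C²` bounded, `Γ ∈ C¹` with `Γ' = G ∈ C⁰` differentiable, `k ≠ 0`, the travelling-wave ODE
  `c²W'' + k²(G'(W)W'² + G(W)W'') = 0` on `ℝ`, and `G` THICK (two different values on every value interval) ⇒ `W` is constant.  So the
  autonomous thick height-evolution has no non-constant bounded plane-wave / travelling-wave slice in any horizontal direction `k` and with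
  any phase speed `c` (including the standing case `c = 0`), while in the (TH) case (`G` constant `= −c²/k²`) EVERY profile `W` solves it —
  the card's «amplitude-dependent speed admits no coherent travelling profile».

Honest scope: the one-phase sub-family only (the 2+1-D two-phase / general bounded data are R3, XL, not in print); kinematic (no NS).
presearch: textbook travelling-wave reduction; the tree's 1-D analogue for the p-system is `…ZShockScalarEternal.travellingWave_const`
(p823407, different hypotheses: nowhere-LD speed, `C¹` profile). [folklore]
-/

noncomputable section

namespace Summit.NavierStokesRegularity.NavierStokesRegularity.Theorems.PoloidalWindowDoorPoloidalWindowRigidityZShockTravellingRigid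

-- the problem directory repeats the summit name (`NavierStokesRegularity/NavierStokesRegularity`)
set_option linter.dupNamespace false

open Set Filter Topology

/-- **The skeleton's kinematic rung** (adapted from `Cruxes/PoloidalWindowRigidity/Lines/z_shock.lean`, `travellingThick_rigid`, planner
ns-idea-8 g0): if `c²·W + k²·Γ∘W ≡ β` for a continuous `W`, `k ≠ 0`, and a differentiable `Γ` whose derivative `G` takes two different
values on every nontrivial value interval (THICK), then `W` is constant. [folklore] -/
theorem travellingThick_rigid {Γ G W : ℝ → ℝ} {c k β : ℝ} (hk : k ≠ 0) (hW : Continuous W)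
    (hΓ : ∀ r, HasDerivAt Γ (G r) r)
    (hrel : ∀ ξ, c ^ 2 * W ξ + k ^ 2 * Γ (W ξ) = β)
    (hthick : ∀ a b : ℝ, a < b → ∃ r ∈ Set.Ioo a b, ∃ r' ∈ Set.Ioo a b, G r ≠ G r') :
    ∀ ξ η, W ξ = W η := by
  -- on any interval of values of `W`, `Γ` is affine with slope `-c²/k²`, contradicting thickness
  have key : ∀ ξ η, W ξ < W η → False := by
    intro ξ η hlt
    set a := W ξ with ha
    set b := W η with hb
    -- every value in `(a, b)` is attained (intermediate value theorem)
    have hIVT : ∀ r ∈ Ioo a b, ∃ θ, W θ = r := by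
      intro r hr
      have hsub := intermediate_value_uIcc (a := ξ) (b := η) hW.continuousOn
      have hr' : r ∈ uIcc (W ξ) (W η) := by
        rw [uIcc_of_le hlt.le]
        exact ⟨hr.1.le, hr.2.le⟩
      obtain ⟨θ, -, hθ⟩ := hsub hr'
      exact ⟨θ, hθ⟩
    -- hence `Γ r = (β - c² r)/k²` on `(a, b)`
    have hGaff : ∀ r ∈ Ioo a b, Γ r = (β - c ^ 2 * r) / k ^ 2 := by
      intro r hr
      obtain ⟨θ, hθ⟩ := hIVT r hr
      have h := hrel θ
      rw [hθ] at h
      have hk2 : k ^ 2 ≠ 0 := pow_ne_zero 2 hk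
      field_simp
      linarith
    -- so `G r = -c²/k²` on `(a, b)`
    have hG'const : ∀ r ∈ Ioo a b, G r = (0 - c ^ 2 * 1) / k ^ 2 := by
      intro r hr
      have hA : HasDerivAt (fun s : ℝ => (β - c ^ 2 * s) / k ^ 2) ((0 - c ^ 2 * 1) / k ^ 2) r :=
        ((hasDerivAt_const r β).sub ((hasDerivAt_id r).const_mul (c ^ 2))).div_const (k ^ 2)
      have hEq : Γ =ᶠ[𝓝 r] fun s : ℝ => (β - c ^ 2 * s) / k ^ 2 :=
        Filter.eventuallyEq_of_mem (Ioo_mem_nhds hr.1 hr.2) fun s hs => hGaff s hs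
      exact (hΓ r).unique (hA.congr_of_eventuallyEq hEq)
    obtain ⟨r, hr, r', hr', hne⟩ := hthick a b hlt
    exact hne (by rw [hG'const r hr, hG'const r' hr'])
  intro ξ η
  rcases lt_trichotomy (W ξ) (W η) with h | h | h
  · exact (key ξ η h).elim
  · exact h
  · exact (key η ξ h).elim

/-- **A `C²` function with vanishing second derivative and bounded values is constant** (`h = h(0) + αξ` and boundedness forces `α = 0`).
[folklore] -/
theorem eq_const_of_deriv2_zero_of_bounded {h h' : ℝ → ℝ} (hh : ∀ ξ, HasDerivAt h (h' ξ) ξ) (hh' : ∀ ξ, HasDerivAt h' 0 ξ)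
    {B : ℝ} (hB : ∀ ξ, |h ξ| ≤ B) : ∀ ξ, h ξ = h 0 := by
  -- `h'` is constant
  have h'const : ∀ ξ, h' ξ = h' 0 := by
    intro ξ
    exact is_const_of_deriv_eq_zero (fun x => (hh' x).differentiableAt) (fun x => (hh' x).deriv) ξ 0
  set α := h' 0 with hα
  -- `h ξ = h 0 + α ξ`
  have haff : ∀ ξ, h ξ = h 0 + α * ξ := by
    intro ξ
    have hd : ∀ x, HasDerivAt (fun x => h x - (h 0 + α * x)) 0 x := by
      intro x
      have h1 := hh x
      rw [h'const x] at h1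
      have h2 : HasDerivAt (fun x => h 0 + α * x) α x := by
        simpa using ((hasDerivAt_id x).const_mul α).const_add (h 0)
      have h3 : HasDerivAt (fun x => h x - (h 0 + α * x)) (α - α) x := h1.sub h2
      simpa using h3
    have hc := is_const_of_deriv_eq_zero (fun x => (hd x).differentiableAt) (fun x => (hd x).deriv) ξ 0
    simp only [mul_zero, add_zero, sub_self] at hc
    linarith
  -- boundedness forces `α = 0`
  have hα0 : α = 0 := by
    by_contra hne
    have hB0 : 0 ≤ B := (abs_nonneg _).trans (hB 0)
    set ξ₀ : ℝ := (2 * B + 1) / α with hξ₀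
    have hαξ : α * ξ₀ = 2 * B + 1 := by rw [hξ₀]; field_simp
    have h1 : |h ξ₀ - h 0| ≤ 2 * B := by
      calc |h ξ₀ - h 0| ≤ |h ξ₀| + |h 0| := abs_sub _ _
        _ ≤ B + B := add_le_add (hB ξ₀) (hB 0)
        _ = 2 * B := by ring
    rw [haff ξ₀, add_sub_cancel_left, hαξ, abs_of_nonneg (by linarith)] at h1
    linarith
  intro ξ
  rw [haff ξ, hα0, zero_mul, add_zero]

/-- **One-phase (travelling / standing plane-wave) solutions of the autonomous THICK height-evolution are constant.**  Let `W ∈ C²(ℝ)` be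
bounded, `Γ` differentiable with derivative `G` (the slope function), `G` differentiable with derivative `G'`, `k ≠ 0`, and suppose the
travelling-wave reduction of `w_zz + Δₕ[Γ(w)] = 0` under `w = W(k·xₕ − c z)` holds:
`c²W''(ξ) + k²·(G'(W ξ)·W'(ξ)² + G(W ξ)·W''(ξ)) = 0` for all `ξ` (`= c²W'' + k²(Γ∘W)''`).  If `G` is THICK (two different values on
every nontrivial value interval), then `W` is constant. [folklore] -/
theorem onePhase_const_of_thick {Γ G G' W W' W'' : ℝ → ℝ} {c k : ℝ} (hk : k ≠ 0)
    (hW : ∀ ξ, HasDerivAt W (W' ξ) ξ) (hW' : ∀ ξ, HasDerivAt W' (W'' ξ) ξ)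
    (hΓ : ∀ r, HasDerivAt Γ (G r) r) (hG : ∀ r, HasDerivAt G (G' r) r)
    (hode : ∀ ξ, c ^ 2 * W'' ξ + k ^ 2 * (G' (W ξ) * W' ξ ^ 2 + G (W ξ) * W'' ξ) = 0)
    {M : ℝ} (hM : ∀ ξ, |W ξ| ≤ M)
    (hthick : ∀ a b : ℝ, a < b → ∃ r ∈ Set.Ioo a b, ∃ r' ∈ Set.Ioo a b, G r ≠ G r') :
    ∀ ξ η, W ξ = W η := by
  -- the first integral `h = c²W + k²Γ∘W`
  set h : ℝ → ℝ := fun ξ => c ^ 2 * W ξ + k ^ 2 * Γ (W ξ) with hh_def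
  set h' : ℝ → ℝ := fun ξ => c ^ 2 * W' ξ + k ^ 2 * (G (W ξ) * W' ξ) with hh'_def
  have hh : ∀ ξ, HasDerivAt h (h' ξ) ξ := by
    intro ξ
    have h1 : HasDerivAt (fun ξ => Γ (W ξ)) (G (W ξ) * W' ξ) ξ := (hΓ (W ξ)).comp ξ (hW ξ)
    exact ((hW ξ).const_mul (c ^ 2)).add (h1.const_mul (k ^ 2))
  have hh' : ∀ ξ, HasDerivAt h' 0 ξ := by
    intro ξ
    have h1 : HasDerivAt (fun ξ => G (W ξ)) (G' (W ξ) * W' ξ) ξ := (hG (W ξ)).comp ξ (hW ξ)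
    have h2 : HasDerivAt (fun ξ => G (W ξ) * W' ξ) (G' (W ξ) * W' ξ * W' ξ + G (W ξ) * W'' ξ) ξ := h1.mul (hW' ξ)
    have h3 := ((hW' ξ).const_mul (c ^ 2)).add (h2.const_mul (k ^ 2))
    have hval : c ^ 2 * W'' ξ + k ^ 2 * (G' (W ξ) * W' ξ * W' ξ + G (W ξ) * W'' ξ) = 0 := by
      have := hode ξ; nlinarith [this]
    rw [hval] at h3
    exact h3
  -- `h` is bounded: `W` takes values in `[-M, M]`, on which the continuous `Γ` is bounded
  have hΓc : Continuous Γ := continuous_iff_continuousAt.2 fun r => (hΓ r).continuousAt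
  obtain ⟨BΓ, hBΓ⟩ := (isCompact_Icc (a := -M) (b := M)).exists_bound_of_continuousOn hΓc.continuousOn
  have hB : ∀ ξ, |h ξ| ≤ c ^ 2 * M + k ^ 2 * BΓ := by
    intro ξ
    have hWξ : W ξ ∈ Icc (-M) M := ⟨neg_le_of_abs_le (hM ξ), le_of_abs_le (hM ξ)⟩
    have h1 : |Γ (W ξ)| ≤ BΓ := by simpa [Real.norm_eq_abs] using hBΓ (W ξ) hWξ
    calc |h ξ| = |c ^ 2 * W ξ + k ^ 2 * Γ (W ξ)| := rfl
      _ ≤ |c ^ 2 * W ξ| + |k ^ 2 * Γ (W ξ)| := abs_add_le _ _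
      _ = c ^ 2 * |W ξ| + k ^ 2 * |Γ (W ξ)| := by
          rw [abs_mul, abs_mul, abs_of_nonneg (sq_nonneg c), abs_of_nonneg (sq_nonneg k)]
      _ ≤ c ^ 2 * M + k ^ 2 * BΓ := by gcongr; exact hM ξ
  have hconst := eq_const_of_deriv2_zero_of_bounded hh hh' hB
  -- conclude with the rung
  have hWc : Continuous W := continuous_iff_continuousAt.2 fun ξ => (hW ξ).continuousAt
  exact travellingThick_rigid (β := h 0) hk hWc hΓ (fun ξ => hconst ξ) hthick

end Summit.NavierStokesRegularity.NavierStokesRegularity.Theorems.PoloidalWindowDoorPoloidalWindowRigidityZShockTravellingRigid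

end
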